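import Literature.MathematicalPhysics.QuantumFieldTheory.Balaban1983to89.B9Thm39PureGaugeClassAtLettersR

/-!
# `Balaban1983to89.B9Thm39FacesAtLettersRC` — rows 15–16 of the N06 knit ([B9] Theorem 3.9 ⇒ Theorem 3.2) at def-Y's letters, RE-PRESSED
# ONCE AT A GENERIC CLASS CONSTANT `c` (and a generic cube-class reading `(R₁, R₂)`): the faces the CASCADE-R STEP-3 edition consumes

T. Bałaban, *Propagators for lattice gauge theories in a background field*, Commun. Math. Phys. **99** (1985) 389–434
[`Balaban1985BackgroundPropagators`, "B9"]; [4] = T. Bałaban, *Propagators and renormalization transformations for lattice gauge theories. II*,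
Commun. Math. Phys. **96** (1984) 223–250 [`Balaban1984PropagatorsII`].  Statement-level skeleton with citation tags; not a claim about the mass gap.

THE PRINTED LOCI (verbatim).  p. 396, (3.35): *«… for a cube □ ∈ 𝒞ⱼ of side cLʲη, c a number ≧ 10»* — the class constant; p. 398, Theorem 3.2 (3.48);
p. 413, Theorem 3.9 (3.98)–(3.99): *«… This theorem implies Theorem 3.2.»*; [4] p. 232, (2.51) (block majorants) and Lemma 2.1 (2.61) p. 234.

WHY THIS FILE (cell context, 2026-08-28).  The rows-15–16 faces of the lineage — `B9Thm39Thm311AtLettersR.t39_hksum_of_pins_opsYOfLettersR`,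
`B9Thm39OneCubeReadingAtLettersY.t39_hksum_oneCube_opsYOfLetters(_F∕R)`, `B9Thm39PureGaugeClassAtLettersR.t39_hksum_oneCube_opsYOfLetters_FR` — carry
the LITERAL class constant `c35Y` (in the guard `c35Y·M·α₀ ≦ a₁`, in the proviso `Reg335 c35Y α₀ U`, and in the conclusion `B9.Thm39Printed (d+1) c35Y …`),
although their common engine `B9Thm39WholeBlkViaDatum.thm39_and_kernelSum_of_pin_rowConst261BlkViaDatum` is typed at a generic constant `c35` with
`0 < c35`.  The CASCADE-R STEP-3 edition of the N06 certificate (dag-n06-d, `R-EDITION-RECIPE.md` §2–§4; node00-def-Y `B9LeafXClassAntitone`) reads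
every face at a GENERIC constant `c` (evaluated at `c := c35B ℓ`, where `B9Eq335ClassBridgePV1` puts print's class inside MODULE 3's), so THIS FILE
re-presses the three faces with `c35Y ↦ c`, `c35Y_pos ↦ (hc : 0 < c)` and nothing else:
* §0 bridges: the display `Conv348Blk` and the Theorem-3.9 datum `EK39OfOpsBlkVia` at the class-parametric one-cube letters `oneCubeOps39Y(F)R … R₁ R₂`
  ARE those at `oneCubeOps39Y(F)` (`Iff.rfl` ∕ `rfl`: same operator letter, same block map, same configurations) — so a Y-typed display ∕ pin feeds
  the R-typed faces;
* §1 generic-letters faces at `(R₁, R₂, c)`: `t39_hksum_of_pins_opsYOfLettersRC` (pins `blk39`), `t39_hksum_of_pins_opsYOfLetters_FRC` (faithful pins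
  `blk39F (bI x)` + n06-i's binder `hβI`);
* §2 one-cube faces at `(R₁, R₂, c)`: `t39_hksum_oneCube_opsYOfLettersRC`, ★★ `t39_hksum_oneCube_opsYOfLetters_FRC` (dag-n06-d's uniform recipe shape:
  objects `bg9YR … R₁ R₂ x`, proviso `(bg9YR … R₁ R₂ x).Reg335 c α₀ U`, guard `c·M·α₀ ≦ a₁`);
* §3 at MODULE 3's families (`bg9Y`, cube class `regY335 ∕ regY336`), constant `c` generic, pin Y-typed VERBATIM as in the certificate: ★★
  `t39_hksum_oneCube_opsYOfLetters_FC` (R-EDITION-RECIPE §4's «minimal road»: the input of def-Y's `b9LeafX_carriersYP_of_statements_at_c35B` at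
  `c := c35B ℓ`), `t39_hksum_of_pins_opsYOfLetters_FC`, `thm32_oneCube_opsYOfLetters_FC`; §4 at print's families (`bg9YP`): `t39_hksum_oneCube_opsYOfLetters_FPC`.

HONEST SCOPE.  Mechanical re-typing of landed faces (every proof is the landed one with `c35Y_pos ↦ hc`); nothing of [B9] or [4] is asserted —
(3.48)⁻¹ (`h348`) and the walk schemas (`h39`) stay DISPLAYED hypotheses of printed shape; NOT a node discharge; count-neutral; one finite 𝕋⁴ programme,
nothing about the mass gap.  Cell `pub-ymgap` (D-0062), node N06 [B9], seat `pub-ymgap-dag-n06-j` gen 24, 2026-08-28.  No `sorry`∕`axiom`∕`instance`∕`def`.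
-/

noncomputable section

namespace Literature.MathematicalPhysics.QuantumFieldTheory.Balaban1983to89.B9Thm39FacesAtLettersRC

open Literature.MathematicalPhysics.QuantumFieldTheory.Balaban1983to89
open Finset B6RandomWalk B9Thm39Whole B9Thm39WholeBlk B9Thm39WholeBlkVia B9Thm39WholeBlkViaDatum B9Thm39ReadingCoords B9Thm39ReadingAtLetters
  B9Thm39ReadingFaithful B9Thm39Thm311AtLettersR B9Thm39OneCubeReadingAtLettersY B9Thm39PureGaugeClassAtLettersR Node00
open B6KLevelCensusIndexV1 B6Geom246MultiLevelBox B6Geom246MultiLevelTorus B6Ineq2142KLevelV1 B6GlobalChartV1 B9PinMembersKLevelV1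
  B9PinCarriersKLevelV1 B9PinGeometryKLevelV1 B7Prop2SpecialUnitary B9Ineq349SiteFromConv348 B9BackgroundsKLevelV1R B9BackgroundsKLevelV1P
  B9GeoLemma21KLevelV1

/-! ## §0 Bridges: the display and the Theorem-3.9 datum at the class-parametric one-cube letters ARE the Y-typed ones -/

section Bridges

open scoped Matrix.Norms.L2Operator

variable {N : ℕ} (θ : Stage3Params) (Mstar : ℕ) (𝔏 : LettersY N θ Mstar)
variable [∀ x : MemberY θ.d₆ θ.ℓ₆ θ.hd' θ.hL' θ.b₀ θ.b₁ Mstar, Fintype (geo9Y x).Site]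
  [∀ x : MemberY θ.d₆ θ.ℓ₆ θ.hd' θ.hL' θ.b₀ θ.b₁ Mstar, DecidableEq (geo9Y x).Site]
variable (R₁ R₂ : RegFamY θ.d₆ θ.ℓ₆ θ.hd' θ.hL' θ.b₀ θ.b₁ Mstar (Matrix (Fin N) (Fin N) ℂ))
variable (bI : ∀ x : MemberY θ.d₆ θ.ℓ₆ θ.hd' θ.hL' θ.b₀ θ.b₁ Mstar, FBondY x.toKIdx → IBondY x.toKIdx)

omit [∀ x : MemberY θ.d₆ θ.ℓ₆ θ.hd' θ.hL' θ.b₀ θ.b₁ Mstar, DecidableEq (geo9Y x).Site] in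
/-- the display `(3.48)⁻¹` at the class-parametric one-cube letters (plain block map) IS the display at the Y-typed ones: `Conv348Blk` reads only the
operator letter `L39(U)` and the block map `blk39`, which the two typings share. [cite: Balaban1985BackgroundPropagators, Thm 3.2 (3.48) p.398 + (3.96) p.411 (bookkeeping: the two typings of the cube class)] -/
theorem conv348Blk_oneCubeYR_iff (x : MemberY θ.d₆ θ.ℓ₆ θ.hd' θ.hL' θ.b₀ θ.b₁ Mstar) (B₁ δ₁ : ℝ)
    (U : (bg9Y (Matrix (Fin N) (Fin N) ℂ) (specialUnitaryUnits (Fin N)) x).Cfg) :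
    Conv348Blk (oneCubeOps39YR θ Mstar 𝔏 R₁ R₂ x) B₁ δ₁ U ↔ Conv348Blk (oneCubeOps39Y θ Mstar 𝔏 x) B₁ δ₁ U :=
  Iff.rfl

omit [∀ x : MemberY θ.d₆ θ.ℓ₆ θ.hd' θ.hL' θ.b₀ θ.b₁ Mstar, DecidableEq (geo9Y x).Site] in
/-- the display `(3.48)⁻¹` at the class-parametric one-cube letters on the FAITHFUL block map IS the display at the Y-typed ones (same `L39(U)`, same
`blk39F (bI x)`). [cite: Balaban1985BackgroundPropagators, Thm 3.2 (3.48) p.398 + (3.96) p.411; Balaban1984PropagatorsII, (2.51) p.232 (bookkeeping)] -/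
theorem conv348Blk_oneCubeYFR_iff (x : MemberY θ.d₆ θ.ℓ₆ θ.hd' θ.hL' θ.b₀ θ.b₁ Mstar) (B₁ δ₁ : ℝ)
    (U : (bg9Y (Matrix (Fin N) (Fin N) ℂ) (specialUnitaryUnits (Fin N)) x).Cfg) :
    Conv348Blk (oneCubeOps39YFR θ Mstar 𝔏 R₁ R₂ bI x) B₁ δ₁ U ↔ Conv348Blk (oneCubeOps39YF θ Mstar 𝔏 bI x) B₁ δ₁ U :=
  Iff.rfl

/-- the Theorem-3.9 kernel-expansion datum at the Y-typed one-cube letters, re-typed over `bg9YR … R₁ R₂ x` (`rwKernelExpansionR`), IS the datum at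
the class-parametric one-cube letters (`rfl`): the certificate's Y-typed `𝔈`-pin `hEK39` transports to the R-typed pin of §2.
[cite: Balaban1985BackgroundPropagators, Thm 3.9 (3.98)–(3.99) p.413 (bookkeeping: the kernel expansion as a datum, two typings)] -/
theorem rwKernelExpansionR_EK39OfOpsBlkVia_oneCubeY (x : MemberY θ.d₆ θ.ℓ₆ θ.hd' θ.hL' θ.b₀ θ.b₁ Mstar) (d : ℕ) (B₁ δ₁ : ℝ)
    (π : (geo9Y x).Site → (geo9Y x).Site) :
    rwKernelExpansionR R₁ R₂ (EK39OfOpsBlkVia (oneCubeOps39Y θ Mstar 𝔏 x) (oneCubeReading39 _) d B₁ δ₁ π) =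
      EK39OfOpsBlkVia (oneCubeOps39YR θ Mstar 𝔏 R₁ R₂ x) (oneCubeReading39 _) d B₁ δ₁ π :=
  rfl

/-- the same on the faithful block map `blk39F (bI x)`. [cite: Balaban1985BackgroundPropagators, Thm 3.9 (3.98)–(3.99) p.413; Balaban1984PropagatorsII, p.248 (bookkeeping)] -/
theorem rwKernelExpansionR_EK39OfOpsBlkVia_oneCubeYF (x : MemberY θ.d₆ θ.ℓ₆ θ.hd' θ.hL' θ.b₀ θ.b₁ Mstar) (d : ℕ) (B₁ δ₁ : ℝ)
    (π : (geo9Y x).Site → (geo9Y x).Site) :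
    rwKernelExpansionR R₁ R₂ (EK39OfOpsBlkVia (oneCubeOps39YF θ Mstar 𝔏 bI x) (oneCubeReading39 _) d B₁ δ₁ π) =
      EK39OfOpsBlkVia (oneCubeOps39YFR θ Mstar 𝔏 R₁ R₂ bI x) (oneCubeReading39 _) d B₁ δ₁ π :=
  rfl

end Bridges

/-! ## §1 The generic-letters faces at generic `(R₁, R₂, c)` -/

section LettersRC

open scoped Matrix.Norms.L2Operator

variable {N : ℕ} (θ : Stage3Params) (Mstar : ℕ) (𝔏 : LettersY N θ Mstar) (𝔈 : ExpsY N θ Mstar)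
variable [∀ x : MemberY θ.d₆ θ.ℓ₆ θ.hd' θ.hL' θ.b₀ θ.b₁ Mstar, Fintype (geo9Y x).Site]
  [∀ x : MemberY θ.d₆ θ.ℓ₆ θ.hd' θ.hL' θ.b₀ θ.b₁ Mstar, DecidableEq (geo9Y x).Site]
variable {ι κ : MemberY θ.d₆ θ.ℓ₆ θ.hd' θ.hL' θ.b₀ θ.b₁ Mstar → Type} [∀ x, Fintype (ι x)]
variable (R₁ R₂ : RegFamY θ.d₆ θ.ℓ₆ θ.hd' θ.hL' θ.b₀ θ.b₁ Mstar (Matrix (Fin N) (Fin N) ℂ))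
variable (bI : ∀ x : MemberY θ.d₆ θ.ℓ₆ θ.hd' θ.hL' θ.b₀ θ.b₁ Mstar, FBondY x.toKIdx → IBondY x.toKIdx)

/-- ★ **ROWS 15 ∧ 16 AT def-Y's OPERATOR LAYER, GENERIC LETTERS, GENERIC `(R₁, R₂, c)`** — `B9Thm39Thm311AtLettersR.t39_hksum_of_pins_opsYOfLettersR` with
the class constant `c35Y` replaced by a GENERIC `c` with `0 < c` (guard `c·M·α₀ ≦ a₁`, proviso `(bg9YR … R₁ R₂ x).Reg335 c α₀ U` = `R₁ x c α₀ U`,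
conclusion `B9.Thm39Printed (θ.d₆+1) c geo9Y (bg9YR … R₁ R₂) (fun x => rwKernelExpansionR R₁ R₂ (ops x).EK39) ∧ B9.RWKernelSumYields …` at
`ops := opsYOfLetters N θ M⋆ 𝔏 𝔈`); same proof ([4] (2.61) by `rowSum261_geo9Y`, the reading by `kerReadsLeVia_opsYOfLettersR`).
[cite: Balaban1985BackgroundPropagators, Thm 3.9 (3.98)–(3.99) p.413 + Thm 3.2 (3.48) p.398 + (3.25) p.395 + (3.35) p.396 («c a number ≧ 10»); Balaban1984PropagatorsII, Lemma 2.1 (2.61) p.234 + (2.51) p.232 + p.248] -/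
theorem t39_hksum_of_pins_opsYOfLettersRC
    (𝔬39 : ∀ x : MemberY θ.d₆ θ.ℓ₆ θ.hd' θ.hL' θ.b₀ θ.b₁ Mstar,
      Ops39Blk (geo9Y x) (bg9YR (Matrix (Fin N) (Fin N) ℂ) (specialUnitaryUnits (Fin N)) R₁ R₂ x) (X39 (Matrix (Fin N) (Fin N) ℂ) x.toKIdx)
        (ι x) (κ x))
    (rd39 : ∀ x : MemberY θ.d₆ θ.ℓ₆ θ.hd' θ.hL' θ.b₀ θ.b₁ Mstar,
      WalkReading39 (bg9YR (Matrix (Fin N) (Fin N) ℂ) (specialUnitaryUnits (Fin N)) R₁ R₂ x) (ι x) (κ x))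
    (c α α' r δ₀ θ₀ B₀ N₀ a₁ M₁ : ℝ) (hc : 0 < c)
    (hα : 0 < α) (hα1 : α < 1) (hα'0 : 0 < α') (hα'1 : α' < 1) (hr : 0 < r) (hrδ : r ≤ δ₀) (hθ₀ : 0 ≤ θ₀) (hB₀ : 0 < B₀)
    (hN₀ : 0 ≤ N₀) (ha₁ : 0 < a₁) (hM₁ : 0 < M₁)
    (hst : ∀ x, StaticOK39Blk (𝔬39 x) N₀) (hloc : ∀ x, Locality39Blk (𝔬39 x) (rd39 x))
    (h39 : ∀ x : MemberY θ.d₆ θ.ℓ₆ θ.hd' θ.hL' θ.b₀ θ.b₁ Mstar, M₁ ≤ (geo9Y x).M → ∀ α₀ : ℝ, 0 < α₀ → c * (geo9Y x).M * α₀ ≤ a₁ →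
      ∀ U : (bg9YR (Matrix (Fin N) (Fin N) ℂ) (specialUnitaryUnits (Fin N)) R₁ R₂ x).Cfg,
        (bg9YR (Matrix (Fin N) (Fin N) ℂ) (specialUnitaryUnits (Fin N)) R₁ R₂ x).Reg335 c α₀ U →
        Local348Blk (𝔬39 x) B₀ δ₀ U ∧ Identities395Blk (𝔬39 x) U ∧ Small285Blk (𝔬39 x) θ₀ r U ∧ Factors389Blk (𝔬39 x) θ₀ δ₀ U)
    (hC : ∀ x : MemberY θ.d₆ θ.ℓ₆ θ.hd' θ.hL' θ.b₀ θ.b₁ Mstar, (𝔏 x).C = CY x.toKIdx (𝔏 x).parS (𝔏 x).Gp)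
    (hblk : ∀ x, (𝔬39 x).blk = blk39 (Matrix (Fin N) (Fin N) ℂ) x.toKIdx)
    (hL : ∀ x, (𝔬39 x).L = L39 x.toKIdx (𝔏 x).parS (𝔏 x).Gp)
    (hEK39 : ∀ x : MemberY θ.d₆ θ.ℓ₆ θ.hd' θ.hL' θ.b₀ θ.b₁ Mstar, rwKernelExpansionR R₁ R₂ ((opsYOfLetters N θ Mstar 𝔏 𝔈) x).EK39 =
      EK39OfOpsBlkVia (𝔬39 x) (rd39 x) (θ.d₆ + 1)
        (2 * (N₀ * B₀) * B9RowSum261DefiniteFaces.rowConst261 (geo9Y (d := θ.d₆) (ℓ := θ.ℓ₆) (hd := θ.hd') (hL := θ.hL')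
          (b₀ := θ.b₀) (b₁ := θ.b₁) (Mstar := Mstar)) (α' * r)) ((1 - α') * r) (repSite39 x.toKIdx)) :
    B9.Thm39Printed (θ.d₆ + 1) c geo9Y (bg9YR (Matrix (Fin N) (Fin N) ℂ) (specialUnitaryUnits (Fin N)) R₁ R₂)
        (fun x => rwKernelExpansionR R₁ R₂ ((opsYOfLetters N θ Mstar 𝔏 𝔈) x).EK39) ∧
      B9.RWKernelSumYields (θ.d₆ + 1) geo9Y (bg9YR (Matrix (Fin N) (Fin N) ℂ) (specialUnitaryUnits (Fin N)) R₁ R₂)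
        (fun x => rwKernelExpansionR R₁ R₂ ((opsYOfLetters N θ Mstar 𝔏 𝔈) x).EK39)
        (fun x => siteKernelR R₁ R₂ ((opsYOfLetters N θ Mstar 𝔏 𝔈) x).Cinv) :=
  thm39_and_kernelSum_of_pin_rowConst261BlkViaDatum 𝔬39 rd39 (fun x => siteKernelR R₁ R₂ ((opsYOfLetters N θ Mstar 𝔏 𝔈) x).Cinv)
    (θ.d₆ + 1) (fun x => repSite39 x.toKIdx) α α' r δ₀ θ₀ B₀ N₀ a₁ M₁ (cR39 (basis39 (Matrix (Fin N) (Fin N) ℂ))) hc hα hα1 hα'0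
    hα'1 hr hrδ hθ₀ hB₀ hN₀ ha₁ hM₁ (cR39_nonneg _) hst hloc rowSum261_geo9Y (fun x y => len_repSite39 x.toKIdx y)
    (fun x y z => dist_repSite39_left x.toKIdx y z) (fun x z y => dist_repSite39_right x.toKIdx z y)
    (kerReadsLeVia_opsYOfLettersR θ Mstar 𝔏 𝔈 R₁ R₂ hC 𝔬39 hblk hL) h39 hEK39

/-- ★ **ROWS 15 ∧ 16 AT def-Y's OPERATOR LAYER, GENERIC LETTERS ON THE FAITHFUL BLOCK MAP, GENERIC `(R₁, R₂, c)`** — the class-parametric × faithful twin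
(`blk39 ↦ blk39F (bI x)`, `repSite39 ↦ repSite39F x.toKIdx (bI x)`, n06-i's geometric binder `hβI`, reading `kerReadsLeVia_opsYOfLettersR_F`) at a
generic class constant `c` with `0 < c`. [cite: Balaban1985BackgroundPropagators, Thm 3.9 (3.98)–(3.99) p.413 + Thm 3.2 (3.48) p.398 + (3.25) p.395 + (3.35) p.396; Balaban1984PropagatorsII, Lemma 2.1 (2.61) p.234 + (2.45) p.231 + (2.51) p.232 + p.248] -/
theorem t39_hksum_of_pins_opsYOfLetters_FRC
    (𝔬39 : ∀ x : MemberY θ.d₆ θ.ℓ₆ θ.hd' θ.hL' θ.b₀ θ.b₁ Mstar,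
      Ops39Blk (geo9Y x) (bg9YR (Matrix (Fin N) (Fin N) ℂ) (specialUnitaryUnits (Fin N)) R₁ R₂ x) (X39 (Matrix (Fin N) (Fin N) ℂ) x.toKIdx)
        (ι x) (κ x))
    (rd39 : ∀ x : MemberY θ.d₆ θ.ℓ₆ θ.hd' θ.hL' θ.b₀ θ.b₁ Mstar,
      WalkReading39 (bg9YR (Matrix (Fin N) (Fin N) ℂ) (specialUnitaryUnits (Fin N)) R₁ R₂ x) (ι x) (κ x))
    (c α α' r δ₀ θ₀ B₀ N₀ a₁ M₁ : ℝ) (hc : 0 < c)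
    (hα : 0 < α) (hα1 : α < 1) (hα'0 : 0 < α') (hα'1 : α' < 1) (hr : 0 < r) (hrδ : r ≤ δ₀) (hθ₀ : 0 ≤ θ₀) (hB₀ : 0 < B₀)
    (hN₀ : 0 ≤ N₀) (ha₁ : 0 < a₁) (hM₁ : 0 < M₁)
    (hst : ∀ x, StaticOK39Blk (𝔬39 x) N₀) (hloc : ∀ x, Locality39Blk (𝔬39 x) (rd39 x))
    (h39 : ∀ x : MemberY θ.d₆ θ.ℓ₆ θ.hd' θ.hL' θ.b₀ θ.b₁ Mstar, M₁ ≤ (geo9Y x).M → ∀ α₀ : ℝ, 0 < α₀ → c * (geo9Y x).M * α₀ ≤ a₁ →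
      ∀ U : (bg9YR (Matrix (Fin N) (Fin N) ℂ) (specialUnitaryUnits (Fin N)) R₁ R₂ x).Cfg,
        (bg9YR (Matrix (Fin N) (Fin N) ℂ) (specialUnitaryUnits (Fin N)) R₁ R₂ x).Reg335 c α₀ U →
        Local348Blk (𝔬39 x) B₀ δ₀ U ∧ Identities395Blk (𝔬39 x) U ∧ Small285Blk (𝔬39 x) θ₀ r U ∧ Factors389Blk (𝔬39 x) θ₀ δ₀ U)
    (hC : ∀ x : MemberY θ.d₆ θ.ℓ₆ θ.hd' θ.hL' θ.b₀ θ.b₁ Mstar, (𝔏 x).C = CY x.toKIdx (𝔏 x).parS (𝔏 x).Gp)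
    (hβI : ∀ (x : MemberY θ.d₆ θ.ℓ₆ θ.hd' θ.hL' θ.b₀ θ.b₁ Mstar) (f : FBondY x.toKIdx) (c : IBondY x.toKIdx),
      blkV1 x.hN x.D f = β x.hN x.D x.hk c → β x.hN x.D x.hk (bI x f) = blkV1 x.hN x.D f)
    (hblk : ∀ x, (𝔬39 x).blk = blk39F (Matrix (Fin N) (Fin N) ℂ) x.toKIdx (bI x))
    (hL : ∀ x, (𝔬39 x).L = L39 x.toKIdx (𝔏 x).parS (𝔏 x).Gp)
    (hEK39 : ∀ x : MemberY θ.d₆ θ.ℓ₆ θ.hd' θ.hL' θ.b₀ θ.b₁ Mstar, rwKernelExpansionR R₁ R₂ ((opsYOfLetters N θ Mstar 𝔏 𝔈) x).EK39 =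
      EK39OfOpsBlkVia (𝔬39 x) (rd39 x) (θ.d₆ + 1)
        (2 * (N₀ * B₀) * B9RowSum261DefiniteFaces.rowConst261 (geo9Y (d := θ.d₆) (ℓ := θ.ℓ₆) (hd := θ.hd') (hL := θ.hL')
          (b₀ := θ.b₀) (b₁ := θ.b₁) (Mstar := Mstar)) (α' * r)) ((1 - α') * r) (repSite39F x.toKIdx (bI x))) :
    B9.Thm39Printed (θ.d₆ + 1) c geo9Y (bg9YR (Matrix (Fin N) (Fin N) ℂ) (specialUnitaryUnits (Fin N)) R₁ R₂)
        (fun x => rwKernelExpansionR R₁ R₂ ((opsYOfLetters N θ Mstar 𝔏 𝔈) x).EK39) ∧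
      B9.RWKernelSumYields (θ.d₆ + 1) geo9Y (bg9YR (Matrix (Fin N) (Fin N) ℂ) (specialUnitaryUnits (Fin N)) R₁ R₂)
        (fun x => rwKernelExpansionR R₁ R₂ ((opsYOfLetters N θ Mstar 𝔏 𝔈) x).EK39)
        (fun x => siteKernelR R₁ R₂ ((opsYOfLetters N θ Mstar 𝔏 𝔈) x).Cinv) :=
  thm39_and_kernelSum_of_pin_rowConst261BlkViaDatum 𝔬39 rd39 (fun x => siteKernelR R₁ R₂ ((opsYOfLetters N θ Mstar 𝔏 𝔈) x).Cinv)
    (θ.d₆ + 1) (fun x => repSite39F x.toKIdx (bI x)) α α' r δ₀ θ₀ B₀ N₀ a₁ M₁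
    (cR39 (basis39 (Matrix (Fin N) (Fin N) ℂ)) * Fintype.card (κ39 (Matrix (Fin N) (Fin N) ℂ))) hc hα hα1 hα'0 hα'1 hr hrδ hθ₀ hB₀ hN₀
    ha₁ hM₁ (mul_nonneg (cR39_nonneg _) (Nat.cast_nonneg _)) hst hloc rowSum261_geo9Y (fun x y => len_repSite39F (hβI x) y)
    (fun x y z => dist_repSite39F_left (hβI x) y z) (fun x z y => dist_repSite39F_right (hβI x) z y)
    (kerReadsLeVia_opsYOfLettersR_F θ Mstar 𝔏 𝔈 R₁ R₂ bI hC 𝔬39 hblk hL) h39 hEK39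

end LettersRC

/-! ## §2 The one-cube faces at generic `(R₁, R₂, c)` (dag-n06-d's uniform recipe shape) -/

section OneCubeRC

open scoped Matrix.Norms.L2Operator

variable {N : ℕ} (θ : Stage3Params) (Mstar : ℕ) (𝔏 : LettersY N θ Mstar) (𝔈 : ExpsY N θ Mstar)
variable [∀ x : MemberY θ.d₆ θ.ℓ₆ θ.hd' θ.hL' θ.b₀ θ.b₁ Mstar, Fintype (geo9Y x).Site]
  [∀ x : MemberY θ.d₆ θ.ℓ₆ θ.hd' θ.hL' θ.b₀ θ.b₁ Mstar, DecidableEq (geo9Y x).Site]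
variable (R₁ R₂ : RegFamY θ.d₆ θ.ℓ₆ θ.hd' θ.hL' θ.b₀ θ.b₁ Mstar (Matrix (Fin N) (Fin N) ℂ))
variable (bI : ∀ x : MemberY θ.d₆ θ.ℓ₆ θ.hd' θ.hL' θ.b₀ θ.b₁ Mstar, FBondY x.toKIdx → IBondY x.toKIdx)

/-- ★ **ROWS 15 ∧ 16 AT GENERIC `(R₁, R₂, c)` FROM ONE DISPLAY** (plain block map `blk39`) — `t39_hksum_oneCube_opsYOfLettersR` with `c35Y ↦ c`, `0 < c`:
IF for every member with `M₁ ≦ M`, every `α₀ > 0` with `c·M·α₀ ≦ a₁` and every `U` with `R₁ x c α₀ U` the genuine `L39(U) = Q′G′²Q′*(U)` has a two-sided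
inverse with block majorant `B₀(Lʲη)⁻⁴e^{−δ₀d}` (display `h348`), THEN the two leaves at class constant `c`.
[cite: Balaban1985BackgroundPropagators, Thm 3.9 (3.98)–(3.99) p.413 + Thm 3.2 (3.48) p.398 + (3.96) p.411 + (3.35) p.396; Balaban1984PropagatorsII, (2.51) p.232 + Lemma 2.1 (2.61) p.234] -/
theorem t39_hksum_oneCube_opsYOfLettersRC (c α' r B₀ δ₀ a₁ M₁ : ℝ) (hc : 0 < c)
    (hα'0 : 0 < α') (hα'1 : α' < 1) (hr : 0 < r) (hrδ : r ≤ δ₀) (hB₀ : 0 < B₀) (ha₁ : 0 < a₁) (hM₁ : 0 < M₁)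
    (h348 : ∀ x : MemberY θ.d₆ θ.ℓ₆ θ.hd' θ.hL' θ.b₀ θ.b₁ Mstar, M₁ ≤ (geo9Y x).M → ∀ α₀ : ℝ, 0 < α₀ → c * (geo9Y x).M * α₀ ≤ a₁ →
      ∀ U : (bg9YR (Matrix (Fin N) (Fin N) ℂ) (specialUnitaryUnits (Fin N)) R₁ R₂ x).Cfg,
        (bg9YR (Matrix (Fin N) (Fin N) ℂ) (specialUnitaryUnits (Fin N)) R₁ R₂ x).Reg335 c α₀ U →
          Conv348Blk (oneCubeOps39YR θ Mstar 𝔏 R₁ R₂ x) B₀ δ₀ U)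
    (hC : ∀ x : MemberY θ.d₆ θ.ℓ₆ θ.hd' θ.hL' θ.b₀ θ.b₁ Mstar, (𝔏 x).C = CY x.toKIdx (𝔏 x).parS (𝔏 x).Gp)
    (hEK39 : ∀ x : MemberY θ.d₆ θ.ℓ₆ θ.hd' θ.hL' θ.b₀ θ.b₁ Mstar,
      rwKernelExpansionR R₁ R₂ ((opsYOfLetters N θ Mstar 𝔏 𝔈) x).EK39 =
      EK39OfOpsBlkVia (oneCubeOps39YR θ Mstar 𝔏 R₁ R₂ x) (oneCubeReading39 _) (θ.d₆ + 1)
        (2 * (1 * B₀) * B9RowSum261DefiniteFaces.rowConst261 (geo9Y (d := θ.d₆) (ℓ := θ.ℓ₆) (hd := θ.hd') (hL := θ.hL')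
          (b₀ := θ.b₀) (b₁ := θ.b₁) (Mstar := Mstar)) (α' * r)) ((1 - α') * r) (repSite39 x.toKIdx)) :
    B9.Thm39Printed (θ.d₆ + 1) c geo9Y (bg9YR (Matrix (Fin N) (Fin N) ℂ) (specialUnitaryUnits (Fin N)) R₁ R₂)
        (fun x => rwKernelExpansionR R₁ R₂ ((opsYOfLetters N θ Mstar 𝔏 𝔈) x).EK39) ∧
      B9.RWKernelSumYields (θ.d₆ + 1) geo9Y (bg9YR (Matrix (Fin N) (Fin N) ℂ) (specialUnitaryUnits (Fin N)) R₁ R₂)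
        (fun x => rwKernelExpansionR R₁ R₂ ((opsYOfLetters N θ Mstar 𝔏 𝔈) x).EK39)
        (fun x => siteKernelR R₁ R₂ ((opsYOfLetters N θ Mstar 𝔏 𝔈) x).Cinv) :=
  t39_hksum_of_pins_opsYOfLettersRC θ Mstar 𝔏 𝔈 R₁ R₂ (fun x => oneCubeOps39YR θ Mstar 𝔏 R₁ R₂ x) (fun _ => oneCubeReading39 _)
    c (1 / 2) α' r δ₀ 0 B₀ 1 a₁ M₁ hc one_half_pos one_half_lt_one hα'0 hα'1 hr hrδ le_rfl hB₀ zero_le_one ha₁ hM₁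
    (fun x => staticOK39Blk_oneCube _ _ (geo9Y_dist_triangle x) (geo9Y_dist_self x) (geo9K_dist_nonneg' x.toKIdx) (geo9Y_len_pos x))
    (fun _ => locality39Blk_oneCube _ _)
    (fun x hM α₀ hα ha U hU => schemas39_oneCube_of_conv348 _ _ r le_rfl (geo9Y_M_nonneg θ Mstar x) (h348 x hM α₀ hα ha U hU))
    hC (fun _ => rfl) (fun _ => rfl) hEK39

/-- ★★ **ROWS 15 ∧ 16 AT GENERIC `(R₁, R₂, c)` FROM ONE DISPLAY ON THE FAITHFUL BLOCK MAP** — `t39_hksum_oneCube_opsYOfLetters_FR` with `c35Y ↦ c`,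
`0 < c`: objects `bg9YR … R₁ R₂ x` (`oneCubeOps39YFR`), display `h348` premised `(bg9YR … R₁ R₂ x).Reg335 c α₀ U` under the guard `c·M·α₀ ≦ a₁`,
n06-i's binder `hβI`, the letter coherence `hC`, the `𝔈`-pin `hEK39` (R-typed; from a Y-typed pin by `rwKernelExpansionR_EK39OfOpsBlkVia_oneCubeYF`);
conclusion the two leaves at class constant `c` — dag-n06-d's CASCADE-R STEP-3 shape (R-EDITION-RECIPE §2–§3).
[cite: Balaban1985BackgroundPropagators, Thm 3.9 (3.98)–(3.99) p.413 + Thm 3.2 (3.48) p.398 + (3.96) p.411 + (3.35) p.396 («c a number ≧ 10»); Balaban1984PropagatorsII, (2.45) p.231 + (2.51) p.232 + Lemma 2.1 (2.61) p.234 + p.248] -/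
theorem t39_hksum_oneCube_opsYOfLetters_FRC (c α' r B₀ δ₀ a₁ M₁ : ℝ) (hc : 0 < c)
    (hα'0 : 0 < α') (hα'1 : α' < 1) (hr : 0 < r) (hrδ : r ≤ δ₀) (hB₀ : 0 < B₀) (ha₁ : 0 < a₁) (hM₁ : 0 < M₁)
    (h348 : ∀ x : MemberY θ.d₆ θ.ℓ₆ θ.hd' θ.hL' θ.b₀ θ.b₁ Mstar, M₁ ≤ (geo9Y x).M → ∀ α₀ : ℝ, 0 < α₀ → c * (geo9Y x).M * α₀ ≤ a₁ →
      ∀ U : (bg9YR (Matrix (Fin N) (Fin N) ℂ) (specialUnitaryUnits (Fin N)) R₁ R₂ x).Cfg,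
        (bg9YR (Matrix (Fin N) (Fin N) ℂ) (specialUnitaryUnits (Fin N)) R₁ R₂ x).Reg335 c α₀ U →
          Conv348Blk (oneCubeOps39YFR θ Mstar 𝔏 R₁ R₂ bI x) B₀ δ₀ U)
    (hC : ∀ x : MemberY θ.d₆ θ.ℓ₆ θ.hd' θ.hL' θ.b₀ θ.b₁ Mstar, (𝔏 x).C = CY x.toKIdx (𝔏 x).parS (𝔏 x).Gp)
    (hβI : ∀ (x : MemberY θ.d₆ θ.ℓ₆ θ.hd' θ.hL' θ.b₀ θ.b₁ Mstar) (f : FBondY x.toKIdx) (c : IBondY x.toKIdx),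
      blkV1 x.hN x.D f = β x.hN x.D x.hk c → β x.hN x.D x.hk (bI x f) = blkV1 x.hN x.D f)
    (hEK39 : ∀ x : MemberY θ.d₆ θ.ℓ₆ θ.hd' θ.hL' θ.b₀ θ.b₁ Mstar,
      rwKernelExpansionR R₁ R₂ ((opsYOfLetters N θ Mstar 𝔏 𝔈) x).EK39 =
      EK39OfOpsBlkVia (oneCubeOps39YFR θ Mstar 𝔏 R₁ R₂ bI x) (oneCubeReading39 _) (θ.d₆ + 1)
        (2 * (1 * B₀) * B9RowSum261DefiniteFaces.rowConst261 (geo9Y (d := θ.d₆) (ℓ := θ.ℓ₆) (hd := θ.hd') (hL := θ.hL')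
          (b₀ := θ.b₀) (b₁ := θ.b₁) (Mstar := Mstar)) (α' * r)) ((1 - α') * r) (repSite39F x.toKIdx (bI x))) :
    B9.Thm39Printed (θ.d₆ + 1) c geo9Y (bg9YR (Matrix (Fin N) (Fin N) ℂ) (specialUnitaryUnits (Fin N)) R₁ R₂)
        (fun x => rwKernelExpansionR R₁ R₂ ((opsYOfLetters N θ Mstar 𝔏 𝔈) x).EK39) ∧
      B9.RWKernelSumYields (θ.d₆ + 1) geo9Y (bg9YR (Matrix (Fin N) (Fin N) ℂ) (specialUnitaryUnits (Fin N)) R₁ R₂)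
        (fun x => rwKernelExpansionR R₁ R₂ ((opsYOfLetters N θ Mstar 𝔏 𝔈) x).EK39)
        (fun x => siteKernelR R₁ R₂ ((opsYOfLetters N θ Mstar 𝔏 𝔈) x).Cinv) :=
  t39_hksum_of_pins_opsYOfLetters_FRC θ Mstar 𝔏 𝔈 R₁ R₂ bI (fun x => oneCubeOps39YFR θ Mstar 𝔏 R₁ R₂ bI x) (fun _ => oneCubeReading39 _)
    c (1 / 2) α' r δ₀ 0 B₀ 1 a₁ M₁ hc one_half_pos one_half_lt_one hα'0 hα'1 hr hrδ le_rfl hB₀ zero_le_one ha₁ hM₁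
    (fun x => staticOK39Blk_oneCube _ _ (geo9Y_dist_triangle x) (geo9Y_dist_self x) (geo9K_dist_nonneg' x.toKIdx) (geo9Y_len_pos x))
    (fun _ => locality39Blk_oneCube _ _)
    (fun x hM α₀ hα ha U hU => schemas39_oneCube_of_conv348 _ _ r le_rfl (geo9Y_M_nonneg θ Mstar x) (h348 x hM α₀ hα ha U hU))
    hC hβI (fun _ => rfl) (fun _ => rfl) hEK39

end OneCubeRC

/-! ## §3 At MODULE 3's families (`bg9Y`): constant `c` generic, objects and pin Y-typed verbatim as in the certificate -/

section StageYC

open scoped Matrix.Norms.L2Operator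

variable {N : ℕ} (θ : Stage3Params) (Mstar : ℕ) (𝔏 : LettersY N θ Mstar) (𝔈 : ExpsY N θ Mstar)
variable [∀ x : MemberY θ.d₆ θ.ℓ₆ θ.hd' θ.hL' θ.b₀ θ.b₁ Mstar, Fintype (geo9Y x).Site]
  [∀ x : MemberY θ.d₆ θ.ℓ₆ θ.hd' θ.hL' θ.b₀ θ.b₁ Mstar, DecidableEq (geo9Y x).Site]
variable {ι κ : MemberY θ.d₆ θ.ℓ₆ θ.hd' θ.hL' θ.b₀ θ.b₁ Mstar → Type} [∀ x, Fintype (ι x)]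
variable (bI : ∀ x : MemberY θ.d₆ θ.ℓ₆ θ.hd' θ.hL' θ.b₀ θ.b₁ Mstar, FBondY x.toKIdx → IBondY x.toKIdx)

/-- ★ **ROWS 15 ∧ 16 AT def-Y's INSTANCE FROM THE FAITHFUL PINS, GENERIC CLASS CONSTANT** — n06-i's `B9Thm39ReadingFaithful.t39_hksum_of_pins_opsYOfLetters_F`
with `c35Y ↦ c`, `0 < c` (objects `bg9Y … x`, proviso `(bg9Y … x).Reg335 c α₀ U`, conclusion `B9.Thm39Printed (θ.d₆+1) c geo9Y (bg9Y …) (fun x => (ops x).EK39)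
∧ B9.RWKernelSumYields …`): the class-parametric face of §1 at MODULE 3's families `(regY335, regY336)` (`bg9Y_eq_bg9YR`; the re-typings are the identity there).
[cite: Balaban1985BackgroundPropagators, Thm 3.9 (3.98)–(3.99) p.413 + Thm 3.2 (3.48) p.398 + (3.25) p.395 + (3.35) p.396; Balaban1984PropagatorsII, Lemma 2.1 (2.61) p.234 + (2.51) p.232 + p.248] -/
theorem t39_hksum_of_pins_opsYOfLetters_FC
    (𝔬39 : ∀ x : MemberY θ.d₆ θ.ℓ₆ θ.hd' θ.hL' θ.b₀ θ.b₁ Mstar,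
      Ops39Blk (geo9Y x) (bg9Y (Matrix (Fin N) (Fin N) ℂ) (specialUnitaryUnits (Fin N)) x) (X39 (Matrix (Fin N) (Fin N) ℂ) x.toKIdx) (ι x) (κ x))
    (rd39 : ∀ x : MemberY θ.d₆ θ.ℓ₆ θ.hd' θ.hL' θ.b₀ θ.b₁ Mstar,
      WalkReading39 (bg9Y (Matrix (Fin N) (Fin N) ℂ) (specialUnitaryUnits (Fin N)) x) (ι x) (κ x))
    (c α α' r δ₀ θ₀ B₀ N₀ a₁ M₁ : ℝ) (hc : 0 < c)
    (hα : 0 < α) (hα1 : α < 1) (hα'0 : 0 < α') (hα'1 : α' < 1) (hr : 0 < r) (hrδ : r ≤ δ₀) (hθ₀ : 0 ≤ θ₀) (hB₀ : 0 < B₀)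
    (hN₀ : 0 ≤ N₀) (ha₁ : 0 < a₁) (hM₁ : 0 < M₁)
    (hst : ∀ x, StaticOK39Blk (𝔬39 x) N₀) (hloc : ∀ x, Locality39Blk (𝔬39 x) (rd39 x))
    (h39 : ∀ x : MemberY θ.d₆ θ.ℓ₆ θ.hd' θ.hL' θ.b₀ θ.b₁ Mstar, M₁ ≤ (geo9Y x).M → ∀ α₀ : ℝ, 0 < α₀ → c * (geo9Y x).M * α₀ ≤ a₁ →
      ∀ U : (bg9Y (Matrix (Fin N) (Fin N) ℂ) (specialUnitaryUnits (Fin N)) x).Cfg,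
        (bg9Y (Matrix (Fin N) (Fin N) ℂ) (specialUnitaryUnits (Fin N)) x).Reg335 c α₀ U →
        Local348Blk (𝔬39 x) B₀ δ₀ U ∧ Identities395Blk (𝔬39 x) U ∧ Small285Blk (𝔬39 x) θ₀ r U ∧ Factors389Blk (𝔬39 x) θ₀ δ₀ U)
    (hC : ∀ x : MemberY θ.d₆ θ.ℓ₆ θ.hd' θ.hL' θ.b₀ θ.b₁ Mstar, (𝔏 x).C = CY x.toKIdx (𝔏 x).parS (𝔏 x).Gp)
    (hβI : ∀ (x : MemberY θ.d₆ θ.ℓ₆ θ.hd' θ.hL' θ.b₀ θ.b₁ Mstar) (f : FBondY x.toKIdx) (c : IBondY x.toKIdx),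
      blkV1 x.hN x.D f = β x.hN x.D x.hk c → β x.hN x.D x.hk (bI x f) = blkV1 x.hN x.D f)
    (hblk : ∀ x, (𝔬39 x).blk = blk39F (Matrix (Fin N) (Fin N) ℂ) x.toKIdx (bI x))
    (hL39 : ∀ x, (𝔬39 x).L = L39 x.toKIdx (𝔏 x).parS (𝔏 x).Gp)
    (hEK39 : ∀ x : MemberY θ.d₆ θ.ℓ₆ θ.hd' θ.hL' θ.b₀ θ.b₁ Mstar, ((opsYOfLetters N θ Mstar 𝔏 𝔈) x).EK39 =
      EK39OfOpsBlkVia (𝔬39 x) (rd39 x) (θ.d₆ + 1)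
        (2 * (N₀ * B₀) * B9RowSum261DefiniteFaces.rowConst261 (geo9Y (d := θ.d₆) (ℓ := θ.ℓ₆) (hd := θ.hd') (hL := θ.hL')
          (b₀ := θ.b₀) (b₁ := θ.b₁) (Mstar := Mstar)) (α' * r)) ((1 - α') * r) (repSite39F x.toKIdx (bI x))) :
    B9.Thm39Printed (θ.d₆ + 1) c geo9Y (bg9Y (Matrix (Fin N) (Fin N) ℂ) (specialUnitaryUnits (Fin N)))
        (fun x => ((opsYOfLetters N θ Mstar 𝔏 𝔈) x).EK39) ∧
      B9.RWKernelSumYields (θ.d₆ + 1) geo9Y (bg9Y (Matrix (Fin N) (Fin N) ℂ) (specialUnitaryUnits (Fin N)))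
        (fun x => ((opsYOfLetters N θ Mstar 𝔏 𝔈) x).EK39) (fun x => ((opsYOfLetters N θ Mstar 𝔏 𝔈) x).Cinv) :=
  t39_hksum_of_pins_opsYOfLetters_FRC θ Mstar 𝔏 𝔈
    (regY335 (Matrix (Fin N) (Fin N) ℂ) (specialUnitaryUnits (Fin N))) (regY336 (Matrix (Fin N) (Fin N) ℂ) (specialUnitaryUnits (Fin N)))
    bI 𝔬39 rd39 c α α' r δ₀ θ₀ B₀ N₀ a₁ M₁ hc hα hα1 hα'0 hα'1 hr hrδ hθ₀ hB₀ hN₀ ha₁ hM₁ hst hloc h39 hC hβI hblk hL39 hEK39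

/-- ★★ **ROWS 15 ∧ 16 AT def-Y's LETTERS FROM ONE DISPLAY ON THE FAITHFUL BLOCK MAP, GENERIC CLASS CONSTANT** —
`B9Thm39OneCubeReadingAtLettersY.t39_hksum_oneCube_opsYOfLetters_F` with `c35Y ↦ c`, `0 < c`: objects `bg9Y … x` (`oneCubeOps39YF`), display `h348`
premised `(bg9Y … x).Reg335 c α₀ U` under the guard `c·M·α₀ ≦ a₁`, `𝔈`-pin `hEK39` Y-typed VERBATIM as the certificate displays it, conclusion
`B9.Thm39Printed (θ.d₆+1) c geo9Y (bg9Y …) (fun x => (ops x).EK39) ∧ B9.RWKernelSumYields (θ.d₆+1) geo9Y (bg9Y …) (fun x => (ops x).EK39) (fun x =>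
(ops x).Cinv)` — the rows-15–16 input of a c-generic Y-edition (dag-n06-d R-EDITION-RECIPE §4; node00-def-Y `b9LeafX_carriersYP_of_statements_at_c35B` at
`c := c35B ℓ`).  §2's class-parametric face at `(regY335, regY336)`.
[cite: Balaban1985BackgroundPropagators, Thm 3.9 (3.98)–(3.99) p.413 + Thm 3.2 (3.48) p.398 + (3.96) p.411 + (3.35) p.396 («c a number ≧ 10»); Balaban1984PropagatorsII, (2.45) p.231 + (2.51) p.232 + Lemma 2.1 (2.61) p.234 + p.248] -/
theorem t39_hksum_oneCube_opsYOfLetters_FC (c α' r B₀ δ₀ a₁ M₁ : ℝ) (hc : 0 < c)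
    (hα'0 : 0 < α') (hα'1 : α' < 1) (hr : 0 < r) (hrδ : r ≤ δ₀) (hB₀ : 0 < B₀) (ha₁ : 0 < a₁) (hM₁ : 0 < M₁)
    (h348 : ∀ x : MemberY θ.d₆ θ.ℓ₆ θ.hd' θ.hL' θ.b₀ θ.b₁ Mstar, M₁ ≤ (geo9Y x).M → ∀ α₀ : ℝ, 0 < α₀ → c * (geo9Y x).M * α₀ ≤ a₁ →
      ∀ U : (bg9Y (Matrix (Fin N) (Fin N) ℂ) (specialUnitaryUnits (Fin N)) x).Cfg,
        (bg9Y (Matrix (Fin N) (Fin N) ℂ) (specialUnitaryUnits (Fin N)) x).Reg335 c α₀ U → Conv348Blk (oneCubeOps39YF θ Mstar 𝔏 bI x) B₀ δ₀ U)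
    (hC : ∀ x : MemberY θ.d₆ θ.ℓ₆ θ.hd' θ.hL' θ.b₀ θ.b₁ Mstar, (𝔏 x).C = CY x.toKIdx (𝔏 x).parS (𝔏 x).Gp)
    (hβI : ∀ (x : MemberY θ.d₆ θ.ℓ₆ θ.hd' θ.hL' θ.b₀ θ.b₁ Mstar) (f : FBondY x.toKIdx) (c : IBondY x.toKIdx),
      blkV1 x.hN x.D f = β x.hN x.D x.hk c → β x.hN x.D x.hk (bI x f) = blkV1 x.hN x.D f)
    (hEK39 : ∀ x : MemberY θ.d₆ θ.ℓ₆ θ.hd' θ.hL' θ.b₀ θ.b₁ Mstar, ((opsYOfLetters N θ Mstar 𝔏 𝔈) x).EK39 =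
      EK39OfOpsBlkVia (oneCubeOps39YF θ Mstar 𝔏 bI x) (oneCubeReading39 _) (θ.d₆ + 1)
        (2 * (1 * B₀) * B9RowSum261DefiniteFaces.rowConst261 (geo9Y (d := θ.d₆) (ℓ := θ.ℓ₆) (hd := θ.hd') (hL := θ.hL')
          (b₀ := θ.b₀) (b₁ := θ.b₁) (Mstar := Mstar)) (α' * r)) ((1 - α') * r) (repSite39F x.toKIdx (bI x))) :
    B9.Thm39Printed (θ.d₆ + 1) c geo9Y (bg9Y (Matrix (Fin N) (Fin N) ℂ) (specialUnitaryUnits (Fin N)))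
        (fun x => ((opsYOfLetters N θ Mstar 𝔏 𝔈) x).EK39) ∧
      B9.RWKernelSumYields (θ.d₆ + 1) geo9Y (bg9Y (Matrix (Fin N) (Fin N) ℂ) (specialUnitaryUnits (Fin N)))
        (fun x => ((opsYOfLetters N θ Mstar 𝔏 𝔈) x).EK39) (fun x => ((opsYOfLetters N θ Mstar 𝔏 𝔈) x).Cinv) :=
  t39_hksum_oneCube_opsYOfLetters_FRC θ Mstar 𝔏 𝔈
    (regY335 (Matrix (Fin N) (Fin N) ℂ) (specialUnitaryUnits (Fin N))) (regY336 (Matrix (Fin N) (Fin N) ℂ) (specialUnitaryUnits (Fin N)))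
    bI c α' r B₀ δ₀ a₁ M₁ hc hα'0 hα'1 hr hrδ hB₀ ha₁ hM₁ h348 hC hβI hEK39

/-- **THEOREM 3.2 AS TYPED BY THE CERTIFICATE, GENERIC CLASS CONSTANT, FROM ONE DISPLAY ON THE FAITHFUL BLOCK MAP**: `B9.Thm32Printed (θ.d₆+1) c geo9Y
(bg9Y …) (fun x => (ops x).Cinv)` — p. 413 «This theorem implies Theorem 3.2» on `t39_hksum_oneCube_opsYOfLetters_FC`.
[cite: Balaban1985BackgroundPropagators, Thm 3.2 (3.48) p.398 + Thm 3.9 p.413 + (3.35) p.396] -/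
theorem thm32_oneCube_opsYOfLetters_FC (c α' r B₀ δ₀ a₁ M₁ : ℝ) (hc : 0 < c)
    (hα'0 : 0 < α') (hα'1 : α' < 1) (hr : 0 < r) (hrδ : r ≤ δ₀) (hB₀ : 0 < B₀) (ha₁ : 0 < a₁) (hM₁ : 0 < M₁)
    (h348 : ∀ x : MemberY θ.d₆ θ.ℓ₆ θ.hd' θ.hL' θ.b₀ θ.b₁ Mstar, M₁ ≤ (geo9Y x).M → ∀ α₀ : ℝ, 0 < α₀ → c * (geo9Y x).M * α₀ ≤ a₁ →
      ∀ U : (bg9Y (Matrix (Fin N) (Fin N) ℂ) (specialUnitaryUnits (Fin N)) x).Cfg,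
        (bg9Y (Matrix (Fin N) (Fin N) ℂ) (specialUnitaryUnits (Fin N)) x).Reg335 c α₀ U → Conv348Blk (oneCubeOps39YF θ Mstar 𝔏 bI x) B₀ δ₀ U)
    (hC : ∀ x : MemberY θ.d₆ θ.ℓ₆ θ.hd' θ.hL' θ.b₀ θ.b₁ Mstar, (𝔏 x).C = CY x.toKIdx (𝔏 x).parS (𝔏 x).Gp)
    (hβI : ∀ (x : MemberY θ.d₆ θ.ℓ₆ θ.hd' θ.hL' θ.b₀ θ.b₁ Mstar) (f : FBondY x.toKIdx) (c : IBondY x.toKIdx),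
      blkV1 x.hN x.D f = β x.hN x.D x.hk c → β x.hN x.D x.hk (bI x f) = blkV1 x.hN x.D f)
    (hEK39 : ∀ x : MemberY θ.d₆ θ.ℓ₆ θ.hd' θ.hL' θ.b₀ θ.b₁ Mstar, ((opsYOfLetters N θ Mstar 𝔏 𝔈) x).EK39 =
      EK39OfOpsBlkVia (oneCubeOps39YF θ Mstar 𝔏 bI x) (oneCubeReading39 _) (θ.d₆ + 1)
        (2 * (1 * B₀) * B9RowSum261DefiniteFaces.rowConst261 (geo9Y (d := θ.d₆) (ℓ := θ.ℓ₆) (hd := θ.hd') (hL := θ.hL')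
          (b₀ := θ.b₀) (b₁ := θ.b₁) (Mstar := Mstar)) (α' * r)) ((1 - α') * r) (repSite39F x.toKIdx (bI x))) :
    B9.Thm32Printed (θ.d₆ + 1) c geo9Y (bg9Y (Matrix (Fin N) (Fin N) ℂ) (specialUnitaryUnits (Fin N)))
      (fun x => ((opsYOfLetters N θ Mstar 𝔏 𝔈) x).Cinv) := by
  obtain ⟨h39, hks⟩ := t39_hksum_oneCube_opsYOfLetters_FC θ Mstar 𝔏 𝔈 bI c α' r B₀ δ₀ a₁ M₁ hc hα'0 hα'1 hr hrδ hB₀ ha₁ hM₁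
    h348 hC hβI hEK39
  exact B9.thm32_of_thm39 _ _ _ _ _ _ h39 hks

end StageYC

/-! ## §4 At print's families (`bg9YP`, «c a number ≧ 10»): constant `c` generic -/

section StageYPC

open scoped Matrix.Norms.L2Operator

variable {N : ℕ} (θ : Stage3Params) (Mstar : ℕ) (𝔏 : LettersY N θ Mstar) (𝔈 : ExpsY N θ Mstar)
variable [∀ x : MemberY θ.d₆ θ.ℓ₆ θ.hd' θ.hL' θ.b₀ θ.b₁ Mstar, Fintype (geo9Y x).Site]
  [∀ x : MemberY θ.d₆ θ.ℓ₆ θ.hd' θ.hL' θ.b₀ θ.b₁ Mstar, DecidableEq (geo9Y x).Site]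
variable (bI : ∀ x : MemberY θ.d₆ θ.ℓ₆ θ.hd' θ.hL' θ.b₀ θ.b₁ Mstar, FBondY x.toKIdx → IBondY x.toKIdx)

/-- ★ **ROWS 15 ∧ 16 FROM ONE DISPLAY ON THE FAITHFUL BLOCK MAP OVER PRINT's CLASS AT A GENERIC CONSTANT** (`bg9YP`, MODULE 3-P): §2's face at
`(R₁, R₂) := (regYP335, regYP336)` (`bg9YP_eq_bg9YR`), by `exact`. [cite: Balaban1985BackgroundPropagators, Thm 3.9 p.413 + Thm 3.2 (3.48) p.398 + (3.35) p.396 («a number ≧ 10»; bookkeeping)] -/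
theorem t39_hksum_oneCube_opsYOfLetters_FPC (c α' r B₀ δ₀ a₁ M₁ : ℝ) (hc : 0 < c)
    (hα'0 : 0 < α') (hα'1 : α' < 1) (hr : 0 < r) (hrδ : r ≤ δ₀) (hB₀ : 0 < B₀) (ha₁ : 0 < a₁) (hM₁ : 0 < M₁)
    (h348 : ∀ x : MemberY θ.d₆ θ.ℓ₆ θ.hd' θ.hL' θ.b₀ θ.b₁ Mstar, M₁ ≤ (geo9Y x).M → ∀ α₀ : ℝ, 0 < α₀ → c * (geo9Y x).M * α₀ ≤ a₁ →
      ∀ U : (bg9YP (Matrix (Fin N) (Fin N) ℂ) (specialUnitaryUnits (Fin N)) x).Cfg,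
        (bg9YP (Matrix (Fin N) (Fin N) ℂ) (specialUnitaryUnits (Fin N)) x).Reg335 c α₀ U →
          Conv348Blk (oneCubeOps39YFR θ Mstar 𝔏 (regYP335 (Matrix (Fin N) (Fin N) ℂ) (specialUnitaryUnits (Fin N)))
            (regYP336 (Matrix (Fin N) (Fin N) ℂ) (specialUnitaryUnits (Fin N))) bI x) B₀ δ₀ U)
    (hC : ∀ x : MemberY θ.d₆ θ.ℓ₆ θ.hd' θ.hL' θ.b₀ θ.b₁ Mstar, (𝔏 x).C = CY x.toKIdx (𝔏 x).parS (𝔏 x).Gp)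
    (hβI : ∀ (x : MemberY θ.d₆ θ.ℓ₆ θ.hd' θ.hL' θ.b₀ θ.b₁ Mstar) (f : FBondY x.toKIdx) (c : IBondY x.toKIdx),
      blkV1 x.hN x.D f = β x.hN x.D x.hk c → β x.hN x.D x.hk (bI x f) = blkV1 x.hN x.D f)
    (hEK39 : ∀ x : MemberY θ.d₆ θ.ℓ₆ θ.hd' θ.hL' θ.b₀ θ.b₁ Mstar,
      rwKernelExpansionR (regYP335 (Matrix (Fin N) (Fin N) ℂ) (specialUnitaryUnits (Fin N)))
          (regYP336 (Matrix (Fin N) (Fin N) ℂ) (specialUnitaryUnits (Fin N))) ((opsYOfLetters N θ Mstar 𝔏 𝔈) x).EK39 =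
      EK39OfOpsBlkVia (oneCubeOps39YFR θ Mstar 𝔏 (regYP335 (Matrix (Fin N) (Fin N) ℂ) (specialUnitaryUnits (Fin N)))
          (regYP336 (Matrix (Fin N) (Fin N) ℂ) (specialUnitaryUnits (Fin N))) bI x) (oneCubeReading39 _) (θ.d₆ + 1)
        (2 * (1 * B₀) * B9RowSum261DefiniteFaces.rowConst261 (geo9Y (d := θ.d₆) (ℓ := θ.ℓ₆) (hd := θ.hd') (hL := θ.hL')
          (b₀ := θ.b₀) (b₁ := θ.b₁) (Mstar := Mstar)) (α' * r)) ((1 - α') * r) (repSite39F x.toKIdx (bI x))) :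
    B9.Thm39Printed (θ.d₆ + 1) c geo9Y (bg9YP (Matrix (Fin N) (Fin N) ℂ) (specialUnitaryUnits (Fin N)))
        (fun x => rwKernelExpansionR (regYP335 (Matrix (Fin N) (Fin N) ℂ) (specialUnitaryUnits (Fin N)))
          (regYP336 (Matrix (Fin N) (Fin N) ℂ) (specialUnitaryUnits (Fin N))) ((opsYOfLetters N θ Mstar 𝔏 𝔈) x).EK39) ∧
      B9.RWKernelSumYields (θ.d₆ + 1) geo9Y (bg9YP (Matrix (Fin N) (Fin N) ℂ) (specialUnitaryUnits (Fin N)))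
        (fun x => rwKernelExpansionR (regYP335 (Matrix (Fin N) (Fin N) ℂ) (specialUnitaryUnits (Fin N)))
          (regYP336 (Matrix (Fin N) (Fin N) ℂ) (specialUnitaryUnits (Fin N))) ((opsYOfLetters N θ Mstar 𝔏 𝔈) x).EK39)
        (fun x => siteKernelR (regYP335 (Matrix (Fin N) (Fin N) ℂ) (specialUnitaryUnits (Fin N)))
          (regYP336 (Matrix (Fin N) (Fin N) ℂ) (specialUnitaryUnits (Fin N))) ((opsYOfLetters N θ Mstar 𝔏 𝔈) x).Cinv) :=
  t39_hksum_oneCube_opsYOfLetters_FRC θ Mstar 𝔏 𝔈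
    (regYP335 (Matrix (Fin N) (Fin N) ℂ) (specialUnitaryUnits (Fin N))) (regYP336 (Matrix (Fin N) (Fin N) ℂ) (specialUnitaryUnits (Fin N)))
    bI c α' r B₀ δ₀ a₁ M₁ hc hα'0 hα'1 hr hrδ hB₀ ha₁ hM₁ h348 hC hβI hEK39

end StageYPC

end Literature.MathematicalPhysics.QuantumFieldTheory.Balaban1983to89.B9Thm39FacesAtLettersRC

end
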